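import Literature.NumberTheory.LFunctions.VanDerCorputZeta
import HarnessLib

/-!
# Partial summation from `n^{-it}` to `n^{-1/2-it}` on a block (Patel–Yang, Lemmas 3.3/3.5)

Topic `Literature/NumberTheory/LFunctions`. Patel–Yang 2024, proof of Lemma 3.3: "by partial
summation, `|∑_{a<n≤b} n^{-1/2-it}| ≤ a^{-1/2} max_{a<L≤b} |∑_{a<n≤L} n^{-it}|`". We PROVE it with
the tree's Abel lemma `Literature.NumberTheory.LFunctions.VdC.abel_bound` (weights `n^{-1/2}`
non-increasing and nonnegative) and `…e_phaseD_zero` (`e(-(t/2π) log n) = n^{-it}`), in the form: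
if `‖∑_{a<n≤L} e(phaseD t 0 n)‖ ≤ B` for all `a < L ≤ b` then
`‖∑_{a<n≤b} n^{-(1/2 + it)}‖ ≤ (a+1)^{-1/2} B ≤ a^{-1/2} B`.

## References

* D. Patel, A. Yang, *An explicit sub-Weyl bound for `ζ(1/2 + it)`*, J. Number Theory 262 (2024),
  proof of Lemma 3.3. [cite: PatelYang2024, Lemma 3.3]
-/

noncomputable section

open Real Set

namespace Literature.NumberTheory.LFunctions
namespace VdC

/-- `n^{-(1/2 + it)} = n^{-1/2} · e(phaseD t 0 n)` for `n ≥ 1`. [folklore] -/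
theorem cpow_neg_half_sub_eq (t : ℝ) {n : ℕ} (hn : 0 < n) :
    (n : ℂ) ^ (-((1 / 2 : ℂ) + t * Complex.I))
      = (((n : ℝ) ^ (-(1 / 2 : ℝ)) : ℝ) : ℂ) * e (phaseD t 0 n) := by
  have hn0 : (n : ℂ) ≠ 0 := by exact_mod_cast hn.ne'
  rw [e_phaseD_zero t hn, neg_add, Complex.cpow_add _ _ hn0]
  congr 1
  rw [Complex.ofReal_cpow (by positivity)]
  push_cast
  ring_nf

/-- **Partial summation on a block** (Patel–Yang, proof of Lemma 3.3): if
`‖∑_{a<n≤L} e(-(t/2π) log n)‖ ≤ B` for every `a < L ≤ b` then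
`‖∑_{a<n≤b} n^{-(1/2+it)}‖ ≤ (a+1)^{-1/2} B`. [cite: PatelYang2024, Lemma 3.3] -/
theorem norm_sum_cpow_le_of_partial {t B : ℝ} {a b : ℕ} (hB : 0 ≤ B)
    (hpart : ∀ L : ℕ, a < L → L ≤ b → ‖∑ n ∈ Finset.Ioc a L, e (phaseD t 0 n)‖ ≤ B) :
    ‖∑ n ∈ Finset.Ioc a b, (n : ℂ) ^ (-((1 / 2 : ℂ) + t * Complex.I))‖
      ≤ ((a : ℝ) + 1) ^ (-(1 / 2 : ℝ)) * B := by
  rcases le_or_gt b a with hle | hlt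
  · rw [Finset.Ioc_eq_empty (by omega), Finset.sum_empty, norm_zero]; positivity
  obtain ⟨m, rfl⟩ : ∃ m, b = a + m := ⟨b - a, by omega⟩
  have hw := abel_bound (fun n => e (phaseD t 0 n)) a hB m (fun n => (n : ℝ) ^ (-(1 / 2 : ℝ)))
    (fun n₁ n₂ h1 h12 _ => Real.rpow_le_rpow_of_nonpos (by exact_mod_cast (show 0 < n₁ by omega))
      (by exact_mod_cast h12) (by norm_num))
    (fun n _ _ => Real.rpow_nonneg (Nat.cast_nonneg n) _) (Real.rpow_nonneg (by positivity) _)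
    hpart
  have hsum : ∑ n ∈ Finset.Ioc a (a + m), (n : ℂ) ^ (-((1 / 2 : ℂ) + t * Complex.I))
      = ∑ n ∈ Finset.Ioc a (a + m), (((n : ℝ) ^ (-(1 / 2 : ℝ)) : ℝ) : ℂ) * e (phaseD t 0 n) := by
    refine Finset.sum_congr rfl fun n hn => ?_
    rw [Finset.mem_Ioc] at hn
    exact cpow_neg_half_sub_eq t (by omega)
  rw [hsum]
  refine hw.trans_eq ?_
  push_cast
  ring

/-- The same with the weaker factor `a^{-1/2}` (`a ≥ 1`). [cite: PatelYang2024, Lemma 3.3] -/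
theorem norm_sum_cpow_le_of_partial' {t B : ℝ} {a b : ℕ} (ha : 1 ≤ a) (hB : 0 ≤ B)
    (hpart : ∀ L : ℕ, a < L → L ≤ b → ‖∑ n ∈ Finset.Ioc a L, e (phaseD t 0 n)‖ ≤ B) :
    ‖∑ n ∈ Finset.Ioc a b, (n : ℂ) ^ (-((1 / 2 : ℂ) + t * Complex.I))‖
      ≤ (a : ℝ) ^ (-(1 / 2 : ℝ)) * B := by
  refine (norm_sum_cpow_le_of_partial hB hpart).trans (mul_le_mul_of_nonneg_right ?_ hB)
  exact Real.rpow_le_rpow_of_nonpos (by exact_mod_cast ha) (by linarith) (by norm_num)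

end VdC
end Literature.NumberTheory.LFunctions
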